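import Summits.QuantumFields.YangMills.Theorems.UnitScaleTiltProp7Lane2CutoffPackage
import Summits.QuantumFields.YangMills.Theorems.UnitScaleTiltProp7Lane2GradCommH1
import HarnessLib

/-!
# Route `UnitScaleTilt`, crux «MinimiserStabilityRegPr» (stmt-QuantumFields-19200), E′ ∕ (N06) LANE II «DIVERGENCE RECOVERY AT CURVED `W`» — brick (B6), THE LEIBNIZ ENERGY BOUND FOR A CUT-OFF FIELD:
# `‖D_W(θφ)‖² ≤ c₀ℓ²·(2·Σ_{x∈T}Σ_μ hs(D_μλ x) + 2d·a²·Σ_{x∈S} hs(λ x))` for `0 ≤ θ ≤ 1` supported in `T`, steps `≤ a`, `S ∋` every target of a θ-changing bond (`d = 3`)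

Cell `ym3-torus`, width seat `ym3-torus-px11` (gen 6); ★p1 g19 RECIPE-hPatch «(R2) and h11 are applied … to `φ′_c := Z̃s_c φ_c` …; `‖DL2 W (ζ̃φ_c)‖² ≤ 2‖DL2 W φ_c‖²|_{Ω_c} + 8R⁻²Φ_c`
(|∇ζ̃| ≤ 2∕(Rℓ), `DL2 = η⁻¹∇`) ⇒ h5».  This is that inequality, with the LOCALISED Dirichlet energy on the right.  THEOREMS ONLY (0 `def`, 0 `sorry`); `--supports stmt-QuantumFields-19200`,
count-neutral.  YM₃ on T³ is a ladder rung (R3), not the Clay problem; nothing here claims (B7), (REC), `hN06`, a stub, the crux, d = 4 or the mass gap.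
* §1 `hs_covD_smul_le` — pointwise Leibniz: `hs(D_μ(θλ)(x)) ≤ 2θ(x)²·hs(D_μλ(x)) + 2(θ(x+e_μ) − θ(x))²·hs(λ(x+e_μ))` (✓`covD_smul_fun_src`, ✓`hs_add_le`, unitary `R`).
* §2 ★★ `norm_sq_DL2_smul_le` — the displayed bound at the member (✓`norm_sq_DL2_toL2S_covD`; site sums shifted by ✓`sum_shift`).
HONEST: pointwise bookkeeping; nothing of (B7)∕(REC)∕hN06∕the crux is proved or claimed.

References: T. Bałaban, CMP 99 (1985) 389–434 [Balaban1985BackgroundPropagators] ((3.3) p.391, (3.11) p.392, (3.100) pp.413–414); CMP 96 (1984) 223–250 [Balaban1984PropagatorsII] (p.238).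
-/

set_option autoImplicit false

noncomputable section

open scoped BigOperators Matrix.Norms.L2Operator Matrix

namespace Summit.QuantumFields.YangMills.Theorems.Prop7Lane2CutoffLeibniz

open Literature.MathematicalPhysics.QuantumFieldTheory.Balaban1983to89
open Literature.MathematicalPhysics.QuantumFieldTheory.Balaban1983to89.T3ContinuumYM3Torus
open T3SectALandauChart (bgUnits eta eta_pos)
open B9Eq39Adjoint (R covD)
open B9TorusCalculus (torusT torusT_apply)
open B11Eq103H1Complex (SiteL2K BondL2K)
open Summit.QuantumFields.YangMills.Theorems.Prop7SectET3Transport (periodsT3)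
open Summit.QuantumFields.YangMills.Theorems.Prop7SectET3HilbertLetters (W₂ toL2 toL2S DL2)
open Summit.QuantumFields.YangMills.Theorems.Prop7CovariantCoercivity (sum_norm_sq_R)
open Summit.QuantumFields.YangMills.Theorems.Prop7CovAgmonLetters (hs_smul covD_smul_fun_src)
open Summit.QuantumFields.YangMills.Theorems.Prop7FlatCoercivity (sum_shift)
open Summit.QuantumFields.YangMills.Theorems.Prop7Lane2CutoffCommutators (coe_bgUnits_mem_unitary)
open Summit.QuantumFields.YangMills.Theorems.Prop7Lane2CutoffPackage (norm_sq_DL2_toL2S_covD)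
open Summit.QuantumFields.YangMills.Theorems.Prop7Lane2GradCommH1 (hs_add_le)
open Summit.QuantumFields.YangMills.Theorems.Prop7Lane2CutoffFamilyRows (card_dir_eq_three)
open Finset

/-! ## §1 Pointwise Leibniz for `D_μ(θλ)` -/

section Point

variable {P : Params} {N : ℕ} (U : Fin P.d → Site P 0 → (Matrix (Fin N) (Fin N) ℂ)ˣ)

/-- **POINTWISE LEIBNIZ**: `hs(D_μ(θλ)(x)) ≤ 2θ(x)²·hs(D_μλ(x)) + 2(θ(x+e_μ) − θ(x))²·hs(λ(x+e_μ))` at a unitary background. [cite: Balaban1985BackgroundPropagators, (3.3) p.391] -/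
theorem hs_covD_smul_le (hUu : ∀ μ x, (U μ x : Matrix (Fin N) (Fin N) ℂ) ∈ unitary (Matrix (Fin N) (Fin N) ℂ))
    (θ : Site P 0 → ℝ) (l : Site P 0 → Matrix (Fin N) (Fin N) ℂ) (μ : Fin P.d) (x : Site P 0) :
    ∑ j : Fin N, ∑ k : Fin N, ‖(covD (torusT P 0) U μ (fun z => θ z • l z) x) j k‖ ^ 2
      ≤ 2 * θ x ^ 2 * ∑ j : Fin N, ∑ k : Fin N, ‖(covD (torusT P 0) U μ l x) j k‖ ^ 2
        + 2 * (θ (x.shift μ) - θ x) ^ 2 * ∑ j : Fin N, ∑ k : Fin N, ‖l (x.shift μ) j k‖ ^ 2 := by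
  rw [covD_smul_fun_src U θ l μ x, torusT_apply]
  refine (hs_add_le _ _).trans (le_of_eq ?_)
  rw [hs_smul (N := N), hs_smul (N := N), sum_norm_sq_R (hUu μ x)]
  ring

end Point

/-! ## §2 ★★ The Leibniz energy bound at the member -/

section Member

variable (F : T3Family) (n K : ℕ) (c₀ : ℝ) [Fact (0 < c₀)] (W : GaugeField (F.P K) 0 (Matrix.specialUnitaryGroup (Fin 2) ℂ))

/-- ★★ **THE LEIBNIZ ENERGY BOUND FOR A CUT-OFF FIELD**: for a real cutoff `0 ≤ θ ≤ 1` vanishing off `T`, with steps `|θ(x+e_μ) − θ(x)| ≤ a` and `S ∋ x+e_μ` whenever `θ(x+e_μ) ≠ θ(x)`,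
`‖D_W(θφ)‖² ≤ c₀ℓ²·(2·Σ_{x∈T}Σ_μ hs(D_μλ(x)) + 6a²·Σ_{x∈S} hs(λ(x)))` (`φ = toL2S λ`, `ℓ = (eta F n K)⁻¹`; first term = twice the Dirichlet energy of `φ` LOCALISED to `T`). With px9's
`ζ̃` (`a = 2(Rℓ)⁻¹`, ✓`abs_plateauCutoff_shift_sub_le`): `≤ 2‖D_Wφ‖²|_T + 24R⁻²·‖φ‖²|_S` — the RECIPE's h5 cure. [cite: Balaban1985BackgroundPropagators, (3.3) p.391, (3.11) p.392, (3.100) pp.413–414] -/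
theorem norm_sq_DL2_smul_le (θ : Site (F.P K) 0 → ℝ) (l : Site (F.P K) 0 → Matrix (Fin 2) (Fin 2) ℂ) {a : ℝ}
    (T S : Finset (Site (F.P K) 0)) (hθ : ∀ x, 0 ≤ θ x ∧ θ x ≤ 1) (hT : ∀ x, θ x ≠ 0 → x ∈ T)
    (ha : ∀ (x : Site (F.P K) 0) (μ : Fin (F.P K).d), |θ (x.shift μ) - θ x| ≤ a)
    (hS : ∀ (x : Site (F.P K) 0) (μ : Fin (F.P K).d), θ (x.shift μ) ≠ θ x → x.shift μ ∈ S) :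
    ‖DL2 F n K c₀ W (toL2S F K c₀ (fun x => θ x • l x))‖ ^ 2
      ≤ c₀ * (eta F n K)⁻¹ ^ 2 * (2 * ∑ x ∈ T, ∑ μ : Fin (F.P K).d, ∑ j : Fin 2, ∑ k' : Fin 2,
            ‖(covD (torusT (F.P K) 0) (fun μ z => bgUnits F K W ⟨z, μ⟩) μ l x) j k'‖ ^ 2
          + 6 * a ^ 2 * ∑ x ∈ S, ∑ j : Fin 2, ∑ k' : Fin 2, ‖l x j k'‖ ^ 2) := by
  classical
  have hc₀ : (0 : ℝ) < c₀ := Fact.out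
  rw [norm_sq_DL2_toL2S_covD F n K c₀ W]
  refine mul_le_mul_of_nonneg_left ?_ (by positivity)
  have hUu : ∀ (μ : Fin (F.P K).d) (x : Site (F.P K) 0),
      ((bgUnits F K W ⟨x, μ⟩ : (Matrix (Fin 2) (Fin 2) ℂ)ˣ) : Matrix (Fin 2) (Fin 2) ℂ) ∈ unitary (Matrix (Fin 2) (Fin 2) ℂ) :=
    fun μ x => coe_bgUnits_mem_unitary F K W μ x
  -- the two pointwise weights
  set G : Fin (F.P K).d → Site (F.P K) 0 → ℝ := fun μ x => ∑ j : Fin 2, ∑ k' : Fin 2,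
    ‖(covD (torusT (F.P K) 0) (fun μ z => bgUnits F K W ⟨z, μ⟩) μ l x) j k'‖ ^ 2 with hG
  set M : Site (F.P K) 0 → ℝ := fun x => ∑ j : Fin 2, ∑ k' : Fin 2, ‖l x j k'‖ ^ 2 with hM
  have hG0 : ∀ μ x, 0 ≤ G μ x := fun μ x => by positivity
  have hM0 : ∀ x, 0 ≤ M x := fun x => by positivity
  -- pointwise: indicator weights
  have hpt : ∀ (x : Site (F.P K) 0) (μ : Fin (F.P K).d),
      ∑ j : Fin 2, ∑ k' : Fin 2, ‖(covD (torusT (F.P K) 0) (fun μ z => bgUnits F K W ⟨z, μ⟩) μ (fun z => θ z • l z) x) j k'‖ ^ 2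
        ≤ 2 * (if x ∈ T then G μ x else 0) + 2 * a ^ 2 * (if x.shift μ ∈ S then M (x.shift μ) else 0) := by
    intro x μ
    refine (hs_covD_smul_le (fun μ z => bgUnits F K W ⟨z, μ⟩) hUu θ l μ x).trans ?_
    have h1 : 2 * θ x ^ 2 * G μ x ≤ 2 * (if x ∈ T then G μ x else 0) := by
      split_ifs with hx
      · have : θ x ^ 2 ≤ 1 := by
          have := hθ x; nlinarith
        nlinarith [hG0 μ x]
      · have hz : θ x = 0 := by
          by_contra h; exact hx (hT x h)
        rw [hz]; simp
    have h2 : 2 * (θ (x.shift μ) - θ x) ^ 2 * M (x.shift μ) ≤ 2 * a ^ 2 * (if x.shift μ ∈ S then M (x.shift μ) else 0) := by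
      split_ifs with hx
      · have hab : (θ (x.shift μ) - θ x) ^ 2 ≤ a ^ 2 := by
          have := ha x μ
          rw [← sq_abs]
          exact pow_le_pow_left₀ (abs_nonneg _) this 2
        nlinarith [hM0 (x.shift μ)]
      · have hz : θ (x.shift μ) - θ x = 0 := by
          by_contra h; exact hx (hS x μ (sub_ne_zero.mp h))
        rw [hz]; simp
    exact add_le_add h1 h2
  -- per site, summed over the directions
  have hptx : ∀ x : Site (F.P K) 0,
      ∑ μ : Fin (F.P K).d, ∑ j : Fin 2, ∑ k' : Fin 2,
          ‖(covD (torusT (F.P K) 0) (fun μ z => bgUnits F K W ⟨z, μ⟩) μ (fun z => θ z • l z) x) j k'‖ ^ 2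
        ≤ 2 * (if x ∈ T then ∑ μ : Fin (F.P K).d, G μ x else 0)
          + 2 * a ^ 2 * ∑ μ : Fin (F.P K).d, (if x.shift μ ∈ S then M (x.shift μ) else 0) := by
    intro x
    refine (Finset.sum_le_sum fun μ _ => hpt x μ).trans (le_of_eq ?_)
    rw [Finset.sum_add_distrib, ← Finset.mul_sum, ← Finset.mul_sum]
    congr 2
    split_ifs <;> simp
  have hsumT : ∑ x : Site (F.P K) 0, (if x ∈ T then ∑ μ : Fin (F.P K).d, G μ x else 0) = ∑ x ∈ T, ∑ μ : Fin (F.P K).d, G μ x := by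
    rw [Finset.sum_ite_mem, Finset.univ_inter]
  have hsumS : ∀ μ : Fin (F.P K).d, ∑ x : Site (F.P K) 0, (if x.shift μ ∈ S then M (x.shift μ) else 0) = ∑ x ∈ S, M x := by
    intro μ
    calc ∑ x : Site (F.P K) 0, (if x.shift μ ∈ S then M (x.shift μ) else 0)
        = ∑ x : Site (F.P K) 0, (if x ∈ S then M x else 0) := sum_shift (P := F.P K) (i := 0) μ (fun y => if y ∈ S then M y else 0)
      _ = ∑ x ∈ S, M x := by rw [Finset.sum_ite_mem, Finset.univ_inter]
  have hS2 : ∑ x : Site (F.P K) 0, ∑ μ : Fin (F.P K).d, (if x.shift μ ∈ S then M (x.shift μ) else 0) = 3 * ∑ x ∈ S, M x := by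
    rw [Finset.sum_comm]
    simp only [hsumS]
    rw [Finset.sum_const, Finset.card_univ, nsmul_eq_mul, card_dir_eq_three]
  -- sum over the sites
  calc ∑ x : Site (F.P K) 0, ∑ μ : Fin (F.P K).d, ∑ j : Fin 2, ∑ k' : Fin 2,
        ‖(covD (torusT (F.P K) 0) (fun μ z => bgUnits F K W ⟨z, μ⟩) μ (fun z => θ z • l z) x) j k'‖ ^ 2
      ≤ ∑ x : Site (F.P K) 0, (2 * (if x ∈ T then ∑ μ : Fin (F.P K).d, G μ x else 0)
          + 2 * a ^ 2 * ∑ μ : Fin (F.P K).d, (if x.shift μ ∈ S then M (x.shift μ) else 0)) :=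
        Finset.sum_le_sum fun x _ => hptx x
    _ = 2 * ∑ x ∈ T, ∑ μ : Fin (F.P K).d, G μ x + 6 * a ^ 2 * ∑ x ∈ S, M x := by
        rw [Finset.sum_add_distrib, ← Finset.mul_sum, ← Finset.mul_sum, hsumT, hS2]
        ring

end Member

end Summit.QuantumFields.YangMills.Theorems.Prop7Lane2CutoffLeibniz

end
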